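import Mathlib
import Literature.MathematicalPhysics.MHD.SolovevFluxSurfaceGGJData
import HarnessLib

/-!
# On every flux surface of the Lee–Cerfon / PCF Solov'ev family, Jardin's Mercier function (8.134) is EXACTLY
# QUADRATIC in the free toroidal-field constant: `F(g) = g²·F(1) + (1 − g²)·F(0)` (proved; no numerics)

Context: `SolovevFluxSurfaceGGJData.lean` (gridfusion-model-5) typed the thirteen inputs of the flux-coordinate
Mercier criterion, Jardin 2010 (8.134) [bib `Jardin2010`], of the surface `r` of `Ψ = psiLC κ F_B R₀ q₀ a` with a
CONSTANT free function `F ≡ g` as `lcGGJData κ F_B R₀ q₀ a g r`, every field an explicit `t`-integral on the printed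
loop [Lee–Cerfon 2015 §4.1, bib `LeeCerfon2015`].

OBSERVATION (elementary; gridfusion-sos-6 g3): for a constant free function (`FF′ = 0`) the field strength on the
surface is `B² = (g² + |∇Ψ|²)/R²` and `σB² = −p′g`, so the two `g`-DEPENDENT averages of (8.134) only ever enter
through the `g`-FREE combination `⟨σ²B²/|∇Ψ|²⟩ + p′²⟨1/B²⟩ = p′²⟨R²/|∇Ψ|²⟩`; the remaining inputs are `V′, V″`
(`g`-free), `Φ″ ∝ g`, `⟨σB²/|∇Ψ|²⟩ ∝ g`, `⟨B²/|∇Ψ|²⟩ = g²⟨1/(R²|∇Ψ|²)⟩ + ⟨1/R²⟩`.  Hence Jardin's `F` is a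
polynomial `M₂g² − M₀` in `g` on every surface, and the Mercier criterion `F > 0` is a pure THRESHOLD in `g²`.

THIS FILE (all surfaces `0 < r < R₀/2`; `κ, F_B, q₀, R₀ > 0`; ANY real `g`):
* `lcJ7_add_sq_mul_lcJ8` — `∫uw/(g²+G) + g²∫uw/((g²+G)G) = ∫uw/G` (pointwise `u/(g²+G) + g²u/((g²+G)G) = u/G`);
* `integral_bsq_split` — `∫(g²+G)w/(uG) = g²∫w/(uG) + ∫w/u`;
* `mercierF_lcGGJData_explicit` — `F(g) = g²·M₂ − M₀` with `M₂, M₀` explicit `g`-free integral expressions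
  (`lcMercierSlope`, `lcMercierIntercept`);
* **`mercierF_lcGGJData_quadratic`** — `F(g) = g²·F(1) + (1 − g²)·F(0)` (definition-free form);
* `mercierCriterion_lcGGJData_iff_of_slope_pos` — if `M₂ > 0`: `MercierCriterion ↔ M₀/M₂ < g²`.
Use: a per-surface certificate needs only the EIGHT `g`-free integrals (no `g`-dependent enclosure, no `g`-uniform
bound); the edge instances are `Bench/SolovevPCF{Iter,Nstx}MercierEdgeThreshold.lean`.
HONEST FRAMING: exact real analysis about MODEL objects (ideal MHD, Solov'ev profiles, analytic fixed boundary);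
Mercier is a NECESSARY criterion; nothing here says anything is stable. Prover: gridfusion-sos-6 (g3), 2026-08-27.
-/

noncomputable section

namespace Literature.MathematicalPhysics.MHD.Solovev

open GradShafranov FluxGeometry Mercier.FluxForm _root_.Real MeasureTheory intervalIntegral _root_.Set

section surface

variable {R₀ κ FB q₀ r : ℝ} (hR₀ : 0 < R₀) (hκ : 0 < κ) (hFB : 0 < FB) (hq₀ : 0 < q₀)
  (hr : 0 < r) (h2r : 2 * r < R₀)
include hR₀ hκ hFB hq₀ hr h2r

omit hκ hFB hq₀ in
/-- Continuity of `t ↦ G = |∇Ψ|²` along the loop of a regular surface. [cite: LeeCerfon2015, §4.1 (boundary parametrisation)] -/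
theorem continuous_lcGradSq : Continuous (lcGradSq κ FB R₀ q₀ r) := by
  have hu : ∀ t, lcU R₀ r t ≠ 0 := fun t => (lcU_pos hR₀ hr.le h2r t).ne'
  have cu : Continuous (lcU R₀ r) := by unfold lcU; fun_prop
  have e : lcGradSq κ FB R₀ q₀ r = fun t => (2 * (κ * FB / (2 * R₀ ^ 3 * q₀)) * r * R₀) ^ 2
      * (lcU R₀ r t * Real.sin t ^ 2 / κ ^ 2
        + (lcU R₀ r t * Real.cos t + r * R₀ * Real.sin t ^ 2) ^ 2 / lcU R₀ r t) := by
    funext t; rfl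
  rw [e]
  have c1 : Continuous fun t => lcU R₀ r t * Real.sin t ^ 2 / κ ^ 2 := by fun_prop
  have c2 : Continuous fun t => (lcU R₀ r t * Real.cos t + r * R₀ * Real.sin t ^ 2) ^ 2 := by fun_prop
  exact continuous_const.mul (c1.add (c2.div₀ cu hu))

omit hR₀ hκ hFB hq₀ hr h2r in
/-- Continuity of `u`. [cite: LeeCerfon2015, §4.1 (boundary parametrisation)] -/
theorem continuous_lcU' : Continuous (lcU R₀ r) := by unfold lcU; fun_prop

/-- **The `g`-dependent averages combine to a `g`-free one:** for every real `g`,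
`∫₀^{2π} uw/(g²+G) dt + g²·∫₀^{2π} uw/((g²+G)G) dt = ∫₀^{2π} uw/G dt`
(pointwise `u/(g²+G) + g²u/((g²+G)G) = u/G`; i.e. `⟨1/B²⟩ + g²⟨1/(B²G)⟩ = ⟨R²/G⟩`, `B²R² = g² + G`).
[cite: Jardin2010, §8.5.4 eq. (8.134)] -/
theorem lcJ7_add_sq_mul_lcJ8 (g : ℝ) :
    (∫ t in (0 : ℝ)..(2 * π), lcU R₀ r t / (g ^ 2 + lcGradSq κ FB R₀ q₀ r t) * lcAvgWeight κ FB R₀ q₀ r t)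
      + g ^ 2 * ∫ t in (0 : ℝ)..(2 * π), lcU R₀ r t
          / ((g ^ 2 + lcGradSq κ FB R₀ q₀ r t) * lcGradSq κ FB R₀ q₀ r t) * lcAvgWeight κ FB R₀ q₀ r t
      = ∫ t in (0 : ℝ)..(2 * π), lcU R₀ r t / lcGradSq κ FB R₀ q₀ r t * lcAvgWeight κ FB R₀ q₀ r t := by
  have hG := lcGradSq_pos hR₀ hκ hFB hq₀ hr h2r
  have hpos : ∀ t, 0 < g ^ 2 + lcGradSq κ FB R₀ q₀ r t := fun t => add_pos_of_nonneg_of_pos (sq_nonneg g) (hG t)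
  have cw := continuous_lcAvgWeight hR₀ hκ hFB hq₀ hr.le h2r
  have cG : Continuous (lcGradSq κ FB R₀ q₀ r) := continuous_lcGradSq hR₀ hr h2r
  have cu : Continuous (lcU R₀ r) := continuous_lcU'
  have c7 : Continuous fun t => lcU R₀ r t / (g ^ 2 + lcGradSq κ FB R₀ q₀ r t) * lcAvgWeight κ FB R₀ q₀ r t :=
    (cu.div₀ (continuous_const.add cG) fun t => (hpos t).ne').mul cw
  have c8 : Continuous fun t => lcU R₀ r t
      / ((g ^ 2 + lcGradSq κ FB R₀ q₀ r t) * lcGradSq κ FB R₀ q₀ r t) * lcAvgWeight κ FB R₀ q₀ r t :=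
    (cu.div₀ ((continuous_const.add cG).mul cG) fun t => mul_ne_zero (hpos t).ne' (hG t).ne').mul cw
  rw [← intervalIntegral.integral_const_mul, ← intervalIntegral.integral_add (c7.intervalIntegrable _ _)
    ((c8.const_mul _).intervalIntegrable _ _)]
  refine intervalIntegral.integral_congr fun t _ => ?_
  have h1 := (hG t).ne'
  have h2 := (hpos t).ne'
  field_simp
  ring

/-- `∫₀^{2π} (g²+G)w/(uG) dt = g²∫₀^{2π} w/(uG) dt + ∫₀^{2π} w/u dt` (`⟨B²/G⟩ = g²⟨1/(R²G)⟩ + ⟨1/R²⟩`).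
[cite: Jardin2010, §8.5.4 eq. (8.134)] -/
theorem integral_bsq_split (g : ℝ) :
    ∫ t in (0 : ℝ)..(2 * π), (g ^ 2 + lcGradSq κ FB R₀ q₀ r t)
        / (lcU R₀ r t * lcGradSq κ FB R₀ q₀ r t) * lcAvgWeight κ FB R₀ q₀ r t
      = g ^ 2 * (∫ t in (0 : ℝ)..(2 * π), lcAvgWeight κ FB R₀ q₀ r t / (lcU R₀ r t * lcGradSq κ FB R₀ q₀ r t))
        + ∫ t in (0 : ℝ)..(2 * π), lcAvgWeight κ FB R₀ q₀ r t / lcU R₀ r t := by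
  have hG := lcGradSq_pos hR₀ hκ hFB hq₀ hr h2r
  have hu := lcU_pos hR₀ hr.le h2r
  have cw := continuous_lcAvgWeight hR₀ hκ hFB hq₀ hr.le h2r
  have cG : Continuous (lcGradSq κ FB R₀ q₀ r) := continuous_lcGradSq hR₀ hr h2r
  have cu : Continuous (lcU R₀ r) := continuous_lcU'
  have ca : Continuous fun t => lcAvgWeight κ FB R₀ q₀ r t / (lcU R₀ r t * lcGradSq κ FB R₀ q₀ r t) :=
    cw.div₀ (cu.mul cG) fun t => mul_ne_zero (hu t).ne' (hG t).ne'
  have cb : Continuous fun t => lcAvgWeight κ FB R₀ q₀ r t / lcU R₀ r t := cw.div₀ cu fun t => (hu t).ne'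
  rw [← intervalIntegral.integral_const_mul, ← intervalIntegral.integral_add ((ca.const_mul _).intervalIntegrable _ _)
    (cb.intervalIntegrable _ _)]
  refine intervalIntegral.integral_congr fun t _ => ?_
  have h1 := (hG t).ne'
  have h2 := (hu t).ne'
  field_simp

/-- The `g`-free SLOPE of Jardin's `F` in `g²` on the surface `r`:
`M₂ = (πΦ₁/V′ + S₁)² − B₁·(C_s²E₁ + C_sV″/V′)` with `Φ₁ = Φ″` at `g = 1`, `S₁ = C_s∫w/G ÷ ∫w`, `B₁ = ∫w/(uG) ÷ ∫w`,
`E₁ = ∫uw/G ÷ ∫w` (all explicit `t`-integrals). [cite: Jardin2010, §8.5.4 eq. (8.134)] -/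
def lcMercierSlope (κ FB R₀ q₀ a r : ℝ) : ℝ :=
  (π * (lcGGJData κ FB R₀ q₀ a 1 r).Φ'' / (lcGGJData κ FB R₀ q₀ a 1 r).V'
      + csLC κ FB R₀ q₀ * ((∫ t in (0 : ℝ)..(2 * π), lcAvgWeight κ FB R₀ q₀ r t / lcGradSq κ FB R₀ q₀ r t)
          / ∫ t in (0 : ℝ)..(2 * π), lcAvgWeight κ FB R₀ q₀ r t)) ^ 2
    - ((∫ t in (0 : ℝ)..(2 * π), lcAvgWeight κ FB R₀ q₀ r t / (lcU R₀ r t * lcGradSq κ FB R₀ q₀ r t))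
          / ∫ t in (0 : ℝ)..(2 * π), lcAvgWeight κ FB R₀ q₀ r t)
      * (csLC κ FB R₀ q₀ ^ 2 * ((∫ t in (0 : ℝ)..(2 * π), lcU R₀ r t / lcGradSq κ FB R₀ q₀ r t
            * lcAvgWeight κ FB R₀ q₀ r t) / ∫ t in (0 : ℝ)..(2 * π), lcAvgWeight κ FB R₀ q₀ r t)
        + csLC κ FB R₀ q₀ * (lcGGJData κ FB R₀ q₀ a 1 r).V'' / (lcGGJData κ FB R₀ q₀ a 1 r).V')

/-- The `g`-free INTERCEPT: `M₀ = B₀·(C_s²E₁ + C_sV″/V′)`, `B₀ = ∫w/u ÷ ∫w`. [cite: Jardin2010, §8.5.4 eq. (8.134)] -/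
def lcMercierIntercept (κ FB R₀ q₀ a r : ℝ) : ℝ :=
  ((∫ t in (0 : ℝ)..(2 * π), lcAvgWeight κ FB R₀ q₀ r t / lcU R₀ r t)
      / ∫ t in (0 : ℝ)..(2 * π), lcAvgWeight κ FB R₀ q₀ r t)
    * (csLC κ FB R₀ q₀ ^ 2 * ((∫ t in (0 : ℝ)..(2 * π), lcU R₀ r t / lcGradSq κ FB R₀ q₀ r t
          * lcAvgWeight κ FB R₀ q₀ r t) / ∫ t in (0 : ℝ)..(2 * π), lcAvgWeight κ FB R₀ q₀ r t)
      + csLC κ FB R₀ q₀ * (lcGGJData κ FB R₀ q₀ a 1 r).V'' / (lcGGJData κ FB R₀ q₀ a 1 r).V')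

/-- **Jardin's `F` of the surface is `g²M₂ − M₀`** for every real `g`. [cite: Jardin2010, §8.5.4 eq. (8.134)] -/
theorem mercierF_lcGGJData_explicit (a g : ℝ) :
    (lcGGJData κ FB R₀ q₀ a g r).mercierF
      = g ^ 2 * lcMercierSlope κ FB R₀ q₀ a r - lcMercierIntercept κ FB R₀ q₀ a r := by
  have hI := integral_lcAvgWeight_pos hR₀ hκ hFB hq₀ hr.le h2r
  have hV1 : (lcGGJData κ FB R₀ q₀ a 1 r).V' = 2 * π * ∫ t in (0 : ℝ)..(2 * π), lcAvgWeight κ FB R₀ q₀ r t :=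
    lcGGJData_V' hR₀ hκ hFB hq₀ hr h2r a 1
  have hV1ne : (lcGGJData κ FB R₀ q₀ a 1 r).V' ≠ 0 := lcGGJData_V'_ne hR₀ hκ hFB hq₀ hr h2r a 1
  have hVg : (lcGGJData κ FB R₀ q₀ a g r).V' = (lcGGJData κ FB R₀ q₀ a 1 r).V' := by
    rw [lcGGJData_V' hR₀ hκ hFB hq₀ hr h2r a g, hV1]
  have hV'' : (lcGGJData κ FB R₀ q₀ a g r).V'' = (lcGGJData κ FB R₀ q₀ a 1 r).V'' := by
    rw [lcGGJData_V'' hR₀ hκ hFB hq₀ hr h2r a g, lcGGJData_V'' hR₀ hκ hFB hq₀ hr h2r a 1]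
  have hΦ : (lcGGJData κ FB R₀ q₀ a g r).Φ'' = g * (lcGGJData κ FB R₀ q₀ a 1 r).Φ'' := by
    rw [lcGGJData_Φ'' hR₀ hκ hFB hq₀ hr h2r a g, lcGGJData_Φ'' hR₀ hκ hFB hq₀ hr h2r a 1]
    ring
  have hσ := lcGGJData_gσB2 hR₀ hκ hFB hq₀ hr h2r a g
  have hσ2 := lcGGJData_gσ2B2 hR₀ hκ hFB hq₀ hr h2r a g
  have hB := lcGGJData_gB2 hR₀ hκ hFB hq₀ hr h2r a g
  have hY := lcGGJData_invB2 hR₀ hκ hFB hq₀ hr h2r a g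
  have hJ := lcJ7_add_sq_mul_lcJ8 hR₀ hκ hFB hq₀ hr h2r g
  have hsplit := integral_bsq_split hR₀ hκ hFB hq₀ hr h2r g
  rw [mercierF_lcGGJData, hVg, hV'', hΦ, hσ, hσ2, hB, hY, hsplit]
  unfold lcMercierSlope lcMercierIntercept
  rw [hV1]
  set Iw := ∫ t in (0 : ℝ)..(2 * π), lcAvgWeight κ FB R₀ q₀ r t with hIw
  set J7 := ∫ t in (0 : ℝ)..(2 * π), lcU R₀ r t / (g ^ 2 + lcGradSq κ FB R₀ q₀ r t) * lcAvgWeight κ FB R₀ q₀ r t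
    with hJ7def
  set J8 := ∫ t in (0 : ℝ)..(2 * π), lcU R₀ r t
          / ((g ^ 2 + lcGradSq κ FB R₀ q₀ r t) * lcGradSq κ FB R₀ q₀ r t) * lcAvgWeight κ FB R₀ q₀ r t with hJ8def
  set E := ∫ t in (0 : ℝ)..(2 * π), lcU R₀ r t / lcGradSq κ FB R₀ q₀ r t * lcAvgWeight κ FB R₀ q₀ r t with hEdef
  set S := ∫ t in (0 : ℝ)..(2 * π), lcAvgWeight κ FB R₀ q₀ r t / lcGradSq κ FB R₀ q₀ r t with hSdef
  set I6a := ∫ t in (0 : ℝ)..(2 * π), lcAvgWeight κ FB R₀ q₀ r t / (lcU R₀ r t * lcGradSq κ FB R₀ q₀ r t)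
    with hI6a
  set I6b := ∫ t in (0 : ℝ)..(2 * π), lcAvgWeight κ FB R₀ q₀ r t / lcU R₀ r t with hI6b
  set Φ1 := (lcGGJData κ FB R₀ q₀ a 1 r).Φ'' with hΦ1
  set V2 := (lcGGJData κ FB R₀ q₀ a 1 r).V'' with hV2
  set C := csLC κ FB R₀ q₀ with hC
  have hJ7 : J7 = E - g ^ 2 * J8 := by linarith
  rw [hJ7]
  have hπ : (π : ℝ) ≠ 0 := Real.pi_ne_zero
  have hIw0 : Iw ≠ 0 := hI.ne'
  field_simp
  ring

/-- **The flux-coordinate Mercier function of the surface is EXACTLY QUADRATIC in the free constant:**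
`F(g) = g²·F(1) + (1 − g²)·F(0)` for every real `g` (definition-free form of `mercierF_lcGGJData_explicit`).
[cite: Jardin2010, §8.5.4 eq. (8.134)] -/
theorem mercierF_lcGGJData_quadratic (a g : ℝ) :
    (lcGGJData κ FB R₀ q₀ a g r).mercierF
      = g ^ 2 * (lcGGJData κ FB R₀ q₀ a 1 r).mercierF + (1 - g ^ 2) * (lcGGJData κ FB R₀ q₀ a 0 r).mercierF := by
  rw [mercierF_lcGGJData_explicit hR₀ hκ hFB hq₀ hr h2r a g, mercierF_lcGGJData_explicit hR₀ hκ hFB hq₀ hr h2r a 1,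
    mercierF_lcGGJData_explicit hR₀ hκ hFB hq₀ hr h2r a 0]
  ring

/-- `F(0) = −M₀` and `F(1) − F(0) = M₂`: the slope and intercept read off two values of `g`. [cite: Jardin2010, §8.5.4 eq. (8.134)] -/
theorem lcMercierSlope_eq (a : ℝ) :
    lcMercierSlope κ FB R₀ q₀ a r = (lcGGJData κ FB R₀ q₀ a 1 r).mercierF - (lcGGJData κ FB R₀ q₀ a 0 r).mercierF
    ∧ lcMercierIntercept κ FB R₀ q₀ a r = -(lcGGJData κ FB R₀ q₀ a 0 r).mercierF := by
  rw [mercierF_lcGGJData_explicit hR₀ hκ hFB hq₀ hr h2r a 1, mercierF_lcGGJData_explicit hR₀ hκ hFB hq₀ hr h2r a 0]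
  constructor <;> ring

/-- **Threshold form of the criterion:** on a surface with positive slope `M₂ > 0`, for every real `g`,
`MercierCriterion ↔ M₀/M₂ < g²` — the criterion is a pure threshold in the squared free constant.
[cite: Jardin2010, §8.5.4 eq. (8.134)] -/
theorem mercierCriterion_lcGGJData_iff_of_slope_pos (a g : ℝ) (hM : 0 < lcMercierSlope κ FB R₀ q₀ a r) :
    (lcGGJData κ FB R₀ q₀ a g r).MercierCriterion
      ↔ lcMercierIntercept κ FB R₀ q₀ a r / lcMercierSlope κ FB R₀ q₀ a r < g ^ 2 := by
  unfold SurfaceData.MercierCriterion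
  rw [mercierF_lcGGJData_explicit hR₀ hκ hFB hq₀ hr h2r a g, div_lt_iff₀ hM]
  exact ⟨fun h => by linarith, fun h => by linarith⟩

/-- Monotonicity in the free constant: with `M₂ > 0`, if the criterion holds at `g₁` it holds at every `g₂` with
`g₁² ≤ g₂²`. [cite: Jardin2010, §8.5.4 eq. (8.134)] -/
theorem mercierCriterion_lcGGJData_mono (a : ℝ) (hM : 0 < lcMercierSlope κ FB R₀ q₀ a r) {g₁ g₂ : ℝ}
    (hg : g₁ ^ 2 ≤ g₂ ^ 2) (h1 : (lcGGJData κ FB R₀ q₀ a g₁ r).MercierCriterion) :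
    (lcGGJData κ FB R₀ q₀ a g₂ r).MercierCriterion := by
  rw [mercierCriterion_lcGGJData_iff_of_slope_pos hR₀ hκ hFB hq₀ hr h2r a _ hM] at h1 ⊢
  exact lt_of_lt_of_le h1 hg

end surface

end Literature.MathematicalPhysics.MHD.Solovev

end
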